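import Literature.Computability.AlgebraicComplexity.MatrixMultiplicationExponent
import HarnessLib

/-!
# Ranks of small matrix multiplication tensors: `R(⟨2,2,2⟩) = 7`, `R(⟨3,3,3⟩) ≥ 19`

Topic `Literature/Computability/AlgebraicComplexity`, over `tensorRank` / `matMulTensor` / `triad`
of `MatrixMultiplicationExponent.lean` (Bläser 2013 conventions: `⟨k,m,n⟩` is the tensor of
`K^{k×m} × K^{m×n} → K^{k×n}`).

Sources and printed statements:
* V. Strassen, *Gaussian elimination is not optimal*, Numer. Math. 13 (1969) 354–356: the seven
  products `M₁ = (A₁₁+A₂₂)(B₁₁+B₂₂), M₂ = (A₂₁+A₂₂)B₁₁, M₃ = A₁₁(B₁₂−B₂₂), M₄ = A₂₂(B₂₁−B₁₁),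
  M₅ = (A₁₁+A₁₂)B₂₂, M₆ = (A₂₁−A₁₁)(B₁₁+B₁₂), M₇ = (A₁₂−A₂₂)(B₂₁+B₂₂)` with
  `C₁₁ = M₁+M₄−M₅+M₇, C₁₂ = M₃+M₅, C₂₁ = M₂+M₄, C₂₂ = M₁−M₂+M₃+M₆` [Strassen1969] — PROVED
  here as a rank bound `R(⟨2,2,2⟩) ≤ 7` over every commutative ring
  (`tensorRank_matMulTensor_two_le_seven`, an explicit 7-triad decomposition checked entrywise).
* M. Bläser, *On the complexity of the multiplication of matrices of small formats*,
  J. Complexity 19 (2003) 43–60 [Blaser2003]: p. 45 "For `⟨2,2,2⟩`, (1) together with Strassen's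
  algorithm yields `R(⟨2,2,2⟩) = 7`; see also [20] (= Winograd 1971) for the lower bound";
  **Corollary 9** (p. 53) "For any field `k`, `R(⟨3,3,3⟩) ≥ 19`"; **Theorem 14** (p. 59) "For any
  field `k` and for all `m ≥ n ≥ 3`, `R(⟨n,m,n⟩) ≥ 2mn + 2n − m − 2`" (Prop. 8: `R(⟨3,m,3⟩) ≥ 5m+4`).
* S. Winograd, *On multiplication of 2×2 matrices*, Linear Algebra Appl. 4 (1971) 381–388
  [Winograd1971] (and Hopcroft–Kerr 1971 [HopcroftKerr1971]): seven multiplications are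
  necessary — the lower bound `R(⟨2,2,2⟩) ≥ 7`, vendored as a NAMED FACT.

Contents:
* `tensorRank_matMulTensor_two_le_seven` (PROVED) — Strassen: `R(⟨2,2,2⟩) ≤ 7`;
* `winograd1971_seven_le_tensorRank_matMulTensor_two` (NAMED FACT) — `7 ≤ R(⟨2,2,2⟩)`, any field;
* `tensorRank_matMulTensor_two_eq_seven` (PROVED from the fact) — `R(⟨2,2,2⟩) = 7`;
* `blaser2003_thm14` (NAMED FACT) — `R(⟨n,m,n⟩) ≥ 2mn + 2n − m − 2` for `m ≥ n ≥ 3`, any field;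
* `blaser2003_cor9` (NAMED FACT, = Thm 14 at `m = n = 3`) — `R(⟨3,3,3⟩) ≥ 19`, any field;
* `blaser2003_cor9_of_thm14` (PROVED) — the corollary from the theorem (`18 + 6 − 3 − 2 = 19`).

Purpose: these numbers are load-bearing in the MatrixMultiplication routes' small-format
arithmetic — route `WindowedCompletionRank` (cruxes `WeylCompletion`, `WeylBeatsTrivial`: with
`|G| = m²` and `R⟨m⟩ ≤ |G|·c`, `R(⟨2,2,2⟩) = 7 > 4` forces completion rank `c(2) = 2` and
`R(⟨3,3,3⟩) ≥ 19 > 18` forces `c(3) = 3`, i.e. no gain at `m ≤ 3`) and route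
`BrentRefutationDepth` (infeasibility of rank `6` for `⟨2,2,2⟩` and of rank `18` for `⟨3,3,3⟩`).
Not here: `R(⟨4,4,4⟩) ≤ 48` over `ℂ` (2025, arXiv:2506.13131) and `R(⟨3,3,3⟩) ≤ 23` (Laderman
1976) — upper bounds by explicit algorithms, to be PROVED by certificate when needed, not vendored.
`ℕ`-subtraction in Thm 14 is harmless (`2mn + 2n ≥ m + 2` when `m ≥ n ≥ 1`).
-/

namespace Literature.Computability.AlgebraicComplexity

open scoped BigOperators

section Strassen

variable (K : Type*) [CommRing K]

/-- The indicator of the matrix position `(i, j)` as a vector on `Fin 2 × Fin 2`. [folklore] -/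
def posInd (i j : Fin 2) : Fin 2 × Fin 2 → K := fun p => if p = (i, j) then 1 else 0

/-- Strassen's seven output patterns `w_r` (coefficient of `M_r` in `C₁₁, C₁₂, C₂₁, C₂₂`).
[cite: Strassen1969] -/
def strassenW : Fin 7 → Fin 2 × Fin 2 → K :=
  ![posInd K 0 0 + posInd K 1 1, posInd K 1 0 - posInd K 1 1, posInd K 0 1 + posInd K 1 1,
    posInd K 0 0 + posInd K 1 0, posInd K 0 1 - posInd K 0 0, posInd K 1 1, posInd K 0 0]

/-- Strassen's seven left factors `u_r` (linear forms in `A`). [cite: Strassen1969] -/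
def strassenU : Fin 7 → Fin 2 × Fin 2 → K :=
  ![posInd K 0 0 + posInd K 1 1, posInd K 1 0 + posInd K 1 1, posInd K 0 0, posInd K 1 1,
    posInd K 0 0 + posInd K 0 1, posInd K 1 0 - posInd K 0 0, posInd K 0 1 - posInd K 1 1]

/-- Strassen's seven right factors `v_r` (linear forms in `B`). [cite: Strassen1969] -/
def strassenV : Fin 7 → Fin 2 × Fin 2 → K :=
  ![posInd K 0 0 + posInd K 1 1, posInd K 0 0, posInd K 0 1 - posInd K 1 1,
    posInd K 1 0 - posInd K 0 0, posInd K 1 1, posInd K 0 0 + posInd K 0 1,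
    posInd K 1 0 + posInd K 1 1]

/-- **Strassen's algorithm as a tensor decomposition**: `⟨2,2,2⟩ = ∑_{r=1}^{7} w_r ⊗ u_r ⊗ v_r`
(Strassen 1969), checked entrywise on all `64` entries. [cite: Strassen1969] -/
theorem matMulTensor_two_eq_sum_strassen :
    matMulTensor K 2 2 2 = ∑ r, triad (strassenW K r) (strassenU K r) (strassenV K r) := by
  funext a b c
  obtain ⟨a1, a2⟩ := a
  obtain ⟨b1, b2⟩ := b
  obtain ⟨c1, c2⟩ := c
  rw [Finset.sum_apply, Finset.sum_apply, Finset.sum_apply]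
  fin_cases a1 <;> fin_cases a2 <;> fin_cases b1 <;> fin_cases b2 <;> fin_cases c1 <;>
    fin_cases c2 <;>
    simp [Fin.sum_univ_seven, triad_apply, strassenW, strassenU, strassenV, posInd, matMulTensor]

/-- **Strassen 1969**: `R(⟨2,2,2⟩) ≤ 7` over every commutative ring. [cite: Strassen1969] -/
theorem tensorRank_matMulTensor_two_le_seven : tensorRank (matMulTensor K 2 2 2) ≤ 7 :=
  tensorRank_le_of_eq_sum _ _ _ (matMulTensor_two_eq_sum_strassen K)

end Strassen

/-- NAMED FACT (**Winograd 1971**; Hopcroft–Kerr 1971; quoted in Bläser 2003, p. 45: "(1) together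
with Strassen's algorithm yields `R(⟨2,2,2⟩) = 7`; see also [20] for the lower bound"): over every
field, every bilinear computation of the `2 × 2` matrix product has length `≥ 7`, i.e.
`7 ≤ R(⟨2,2,2⟩)`. Users take `(h : winograd1971_seven_le_tensorRank_matMulTensor_two)`.
[cite: Winograd1971] -/
def winograd1971_seven_le_tensorRank_matMulTensor_two : Prop :=
  ∀ (K : Type) [Field K], 7 ≤ tensorRank (matMulTensor K 2 2 2)

/-- `R(⟨2,2,2⟩) = 7` over every field (Bläser 2003, p. 45), from Strassen's upper bound (proved)
and Winograd's lower bound (named fact). [cite: Blaser2003, p. 45] -/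
theorem tensorRank_matMulTensor_two_eq_seven (h : winograd1971_seven_le_tensorRank_matMulTensor_two)
    (K : Type) [Field K] : tensorRank (matMulTensor K 2 2 2) = 7 :=
  le_antisymm (tensorRank_matMulTensor_two_le_seven K) (h K)

/-- NAMED FACT (**Bläser 2003, Theorem 14**): "For any field `k` and for all `m ≥ n ≥ 3`,
`R(⟨n,m,n⟩) ≥ 2mn + 2n − m − 2`" (`⟨n,m,n⟩` = product of `n × m` by `m × n` matrices, i.e.
`matMulTensor K n m n`). Users take `(h : blaser2003_thm14)`. [cite: Blaser2003, Theorem 14] -/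
def blaser2003_thm14 : Prop :=
  ∀ (K : Type) [Field K] (m n : ℕ), 3 ≤ n → n ≤ m →
    2 * m * n + 2 * n - m - 2 ≤ tensorRank (matMulTensor K n m n)

/-- NAMED FACT (**Bläser 2003, Corollary 9**): "For any field `k`, `R(⟨3,3,3⟩) ≥ 19`."
(Best known lower bound for `3 × 3`; the upper bound is Laderman's `23`.) Users take
`(h : blaser2003_cor9)`; it follows from `blaser2003_thm14` (`blaser2003_cor9_of_thm14`).
[cite: Blaser2003, Corollary 9] -/
def blaser2003_cor9 : Prop :=
  ∀ (K : Type) [Field K], 19 ≤ tensorRank (matMulTensor K 3 3 3)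

/-- Corollary 9 is Theorem 14 at `m = n = 3` (`2·9 + 6 − 3 − 2 = 19`). [cite: Blaser2003, Corollary 9] -/
theorem blaser2003_cor9_of_thm14 (h : blaser2003_thm14) : blaser2003_cor9 := by
  intro K _
  simpa using h K 3 3 le_rfl le_rfl

end Literature.Computability.AlgebraicComplexity
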